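import Literature.MathematicalPhysics.QuantumFieldTheory.Balaban1983to89.B1Eq324BenfattoSect5LegGeometry
import HarnessLib

/-!
# `Balaban1983to89.B1Eq324BenfattoSect5CrossCount` — [BenfattoEtAl1978] §5 p. 159 «Collecting all the errors made in this process
# (4.7) is proven»: the EXTENSIVE COUNTING LEMMA for anchored cross-cluster sums — summing a weight that decays in the distance of the
# FARTHEST of `n` tesserae from an anchor costs a constant to the power `n`, uniformly in the volume — PROVED

statement-level skeleton of published theorems with citation tags; proofs where landed; nothing here is a claim about the
Yang–Mills mass gap

WHY THIS MODULE (cell `pub-ymgap`, seat `dag-n08-c`, node N08; layer 3 of the assembly census `pub-ymgap-dag-n08-b/N08-BCG-ASSEMBLY-MAP.md`).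
The pavement-step localisation identity `B1Eq324BenfattoSect5FreeCumulants.cumulantOf_telescope_eq_sum_local_add_cross` (n08-b) leaves a
sum over CROSS colourings, bounded by the anchored form `abs_sum_cross_le_sum_anchored`: `Σ_m Σ_{f uses A_m, leaves □_m} |𝓔̂^T_0(Y_f)|`.
Each term is bounded by the uniform Appendix D bound `B1Eq324BenfattoSect5TupleClusters.abs_ursellOf_tupleSums_condField_le_exp_of_separated`
(at `Γ = ∅`) with the designated far slot the piece FARTHEST from `□_m`: `≤ C·e^{−c·max_i dist(□_m, piece_i)}·Π masses`.  What makes the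
result `|I|·O(1)` rather than `volume^k` — print's errors are all of the form `|I|·S(…)` — is that the remaining sum over the positions of the
other pieces of a weight decaying in the MAXIMAL distance is bounded uniformly in the volume: `max ≥ mean` turns `e^{−c·max}` into a
product of one-tessera factors, and each one-tessera lattice sum is the volume-uniform constant of
`B1Eq324BenfattoConnLength.sum_exp_neg_mul_cubeDist_le` (the «|I|»-extensivity mechanism of (5.11)).  This file proves that counting
lemma in the `ℓ¹` vocabulary of `…AppendixDWick` §5 / `…LegGeometry` / `…TupleClusters`.

WHAT IS PROVED (theorems only; no definition, no named fact, no `sorry`; axioms standard).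
* `cubeDist_le_l1` — `cubeDist x y ≤ Σ_j |x_j − y_j|`.
* `sum_exp_neg_mul_l1_le` — `Σ_{y∈F} e^{−c·ℓ¹(x,y)} ≤ K(c,d) := (2/(1−e^{−c/√d})·e^{c/√d})^d` for every finite `F ⊂ ℤ^d`, every `x`, `c > 0`.
* ★★ **`sum_piFinset_exp_neg_mul_le_pow`** — for `c > 0`, `n ≥ 1` and any `ρ : (Fin n → ℤ^d) → ℝ` with `ℓ¹(x, y_i) ≤ ρ(y)` for all `i`
  (e.g. the distance of the farthest tessera): `Σ_{y ∈ F^n} e^{−c·ρ(y)} ≤ K(c/n, d)^n`, uniformly in `|F|`.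
* `sum_piFinset_exp_neg_mul_sup_le_pow` — the instance `ρ(y) = max_i ℓ¹(x, y_i)` (`Finset.sup'`).

HONEST SCOPE / NOT HERE.  Pure lattice counting; the split of the rest `H_{Γ₁} + Σ_mΨ₂(□_m)` into local pieces, the pairing with
`…FreeCumulants` and `…TupleClusters`, the masses and the collection into `errTerm` are the assembly's; `BasicLemmaPrinted` stays OPEN.
NOT summit progress; count-neutral for N08; nothing of [Balaban1985UV3] is asserted.
-/

open Finset
open scoped BigOperators

namespace Literature.MathematicalPhysics.QuantumFieldTheory.Balaban1983to89.B1Eq324BenfattoSect5CrossCount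

open Literature.MathematicalPhysics.QuantumFieldTheory.Balaban1983to89.B1Eq324BenfattoLemma
open Literature.MathematicalPhysics.QuantumFieldTheory.Balaban1983to89.B1Eq324BenfattoConnLength (sum_exp_neg_mul_cubeDist_le)

variable {d : ℕ}

/-- **`cubeDist x y ≤ ℓ¹(x, y)`**: the Euclidean norm of the gap vector `(max(|x_j − y_j| − 1, 0))_j` is at most its `ℓ¹` norm, which is at
most `Σ_j |x_j − y_j|`. [cite: BenfattoEtAl1978, after (2.3) p.146] -/
theorem cubeDist_le_l1 (x y : B1Eq324BenfattoLemma.Site d) : cubeDist x y ≤ ∑ j, |((x j : ℝ) - (y j : ℝ))| := by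
  have hg0 : ∀ j : Fin d, 0 ≤ max (|((x j : ℝ) - (y j : ℝ))| - 1) 0 := fun j => le_max_right _ _
  have hg1 : ∀ j : Fin d, max (|((x j : ℝ) - (y j : ℝ))| - 1) 0 ≤ |((x j : ℝ) - (y j : ℝ))| := fun j =>
    max_le (by linarith [abs_nonneg (((x j : ℝ) - (y j : ℝ)))]) (abs_nonneg _)
  have hsum0 : 0 ≤ ∑ j, max (|((x j : ℝ) - (y j : ℝ))| - 1) 0 := Finset.sum_nonneg fun j _ => hg0 j
  calc cubeDist x y = Real.sqrt (∑ j, max (|((x j : ℝ) - (y j : ℝ))| - 1) 0 ^ 2) := rfl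
    _ ≤ Real.sqrt ((∑ j, max (|((x j : ℝ) - (y j : ℝ))| - 1) 0) ^ 2) :=
        Real.sqrt_le_sqrt (Finset.sum_sq_le_sq_sum_of_nonneg fun j _ => hg0 j)
    _ = ∑ j, max (|((x j : ℝ) - (y j : ℝ))| - 1) 0 := Real.sqrt_sq hsum0
    _ ≤ ∑ j, |((x j : ℝ) - (y j : ℝ))| := Finset.sum_le_sum fun j _ => hg1 j

/-- **THE ONE-TESSERA LATTICE SUM IN `ℓ¹`**: for `c > 0`, every finite `F ⊂ ℤ^d` and every `x`,
`Σ_{y∈F} e^{−c·Σ_j|x_j − y_j|} ≤ (2/(1 − e^{−c/√d})·e^{c/√d})^d` — uniformly in `F` (`B1Eq324BenfattoConnLength.sum_exp_neg_mul_cubeDist_le`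
and `cubeDist ≤ ℓ¹`). [cite: BenfattoEtAl1978, (5.11) p.155] -/
theorem sum_exp_neg_mul_l1_le {c : ℝ} (hc : 0 < c) (F : Finset (B1Eq324BenfattoLemma.Site d)) (x : B1Eq324BenfattoLemma.Site d) :
    ∑ y ∈ F, Real.exp (-(c * ∑ j, |((x j : ℝ) - (y j : ℝ))|)) ≤
      (2 / (1 - Real.exp (-(c / Real.sqrt d))) * Real.exp (c / Real.sqrt d)) ^ d := by
  refine (Finset.sum_le_sum fun y _ => ?_).trans (sum_exp_neg_mul_cubeDist_le hc F x)
  exact Real.exp_le_exp.2 (by nlinarith [cubeDist_le_l1 x y])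

/-- **THE EXTENSIVE COUNTING LEMMA** («max ≥ mean»): for `c > 0`, `n ≥ 1`, a finite `F ⊂ ℤ^d`, an anchor `x` and ANY function `ρ` on
`n`-tuples of tesserae of `F` dominating every `ℓ¹(x, y_i)` (e.g. the distance of the farthest one),
`Σ_{y ∈ F^n} e^{−c·ρ(y)} ≤ K(c/n, d)^n`, `K(c', d) = (2/(1 − e^{−c'/√d})·e^{c'/√d})^d` — uniformly in `|F|`:
`e^{−c·ρ(y)} ≤ Π_i e^{−(c/n)·ℓ¹(x, y_i)}` and the sum of the product factorises (`Finset.sum_pow'`) into `n` one-tessera sums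
(`sum_exp_neg_mul_l1_le`). [cite: BenfattoEtAl1978, §5 p.159 «Collecting all the errors»] -/
theorem sum_piFinset_exp_neg_mul_le_pow {c : ℝ} (hc : 0 < c) {n : ℕ} (hn : 1 ≤ n) (F : Finset (B1Eq324BenfattoLemma.Site d))
    (x : B1Eq324BenfattoLemma.Site d) (ρ : (Fin n → B1Eq324BenfattoLemma.Site d) → ℝ)
    (hρ : ∀ y ∈ Fintype.piFinset (fun _ : Fin n => F), ∀ i, (∑ j, |((x j : ℝ) - (y i j : ℝ))|) ≤ ρ y) :
    ∑ y ∈ Fintype.piFinset (fun _ : Fin n => F), Real.exp (-(c * ρ y)) ≤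
      ((2 / (1 - Real.exp (-(c / n / Real.sqrt d))) * Real.exp (c / n / Real.sqrt d)) ^ d) ^ n := by
  have hn0 : (0 : ℝ) < n := by exact_mod_cast hn
  have hcn : 0 < c / n := div_pos hc hn0
  -- `e^{−cρ} ≤ Π_i e^{−(c/n)ℓ¹(x, y_i)}`
  have hstep : ∀ y ∈ Fintype.piFinset (fun _ : Fin n => F),
      Real.exp (-(c * ρ y)) ≤ ∏ i, Real.exp (-(c / n * ∑ j, |((x j : ℝ) - (y i j : ℝ))|)) := by
    intro y hy
    rw [← Real.exp_sum, Real.exp_le_exp, Finset.sum_neg_distrib]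
    have hsum : ∑ i : Fin n, (c / n * ∑ j, |((x j : ℝ) - (y i j : ℝ))|) ≤ ∑ _i : Fin n, c / n * ρ y :=
      Finset.sum_le_sum fun i _ => mul_le_mul_of_nonneg_left (hρ y hy i) hcn.le
    rw [Finset.sum_const, Finset.card_univ, Fintype.card_fin, nsmul_eq_mul] at hsum
    have hcalc : (n : ℝ) * (c / n * ρ y) = c * ρ y := by field_simp
    rw [hcalc] at hsum
    linarith
  calc ∑ y ∈ Fintype.piFinset (fun _ : Fin n => F), Real.exp (-(c * ρ y))
      ≤ ∑ y ∈ Fintype.piFinset (fun _ : Fin n => F), ∏ i, Real.exp (-(c / n * ∑ j, |((x j : ℝ) - (y i j : ℝ))|)) :=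
        Finset.sum_le_sum hstep
    _ = (∑ z ∈ F, Real.exp (-(c / n * ∑ j, |((x j : ℝ) - (z j : ℝ))|))) ^ n :=
        (Finset.sum_pow' F (fun z => Real.exp (-(c / n * ∑ j, |((x j : ℝ) - (z j : ℝ))|))) n).symm
    _ ≤ ((2 / (1 - Real.exp (-(c / n / Real.sqrt d))) * Real.exp (c / n / Real.sqrt d)) ^ d) ^ n :=
        pow_le_pow_left₀ (Finset.sum_nonneg fun z _ => (Real.exp_pos _).le) (sum_exp_neg_mul_l1_le hcn F x) n

/-- **The farthest-tessera instance**: with `ρ(y) = max_i ℓ¹(x, y_i)` (`Finset.sup'` over the nonempty `Fin n`, `n ≥ 1`),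
`Σ_{y ∈ F^n} e^{−c·max_i ℓ¹(x, y_i)} ≤ K(c/n, d)^n`. [cite: BenfattoEtAl1978, §5 p.159 «Collecting all the errors»] -/
theorem sum_piFinset_exp_neg_mul_sup_le_pow {c : ℝ} (hc : 0 < c) {n : ℕ} (hn : 1 ≤ n) (F : Finset (B1Eq324BenfattoLemma.Site d))
    (x : B1Eq324BenfattoLemma.Site d) :
    ∑ y ∈ Fintype.piFinset (fun _ : Fin n => F),
        Real.exp (-(c * (Finset.univ : Finset (Fin n)).sup'
          (Finset.univ_nonempty_iff.2 ⟨⟨0, hn⟩⟩) (fun i => ∑ j, |((x j : ℝ) - (y i j : ℝ))|))) ≤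
      ((2 / (1 - Real.exp (-(c / n / Real.sqrt d))) * Real.exp (c / n / Real.sqrt d)) ^ d) ^ n :=
  sum_piFinset_exp_neg_mul_le_pow hc hn F x _ fun y _ i =>
    Finset.le_sup' (fun i => ∑ j, |((x j : ℝ) - (y i j : ℝ))|) (Finset.mem_univ i)

end Literature.MathematicalPhysics.QuantumFieldTheory.Balaban1983to89.B1Eq324BenfattoSect5CrossCount
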